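import Summits.BirchSwinnertonDyer.Rank1Residual.X12.O11.RamifiedStrictDescent
import Summits.BirchSwinnertonDyer.BirchSwinnertonDyer.Theorems.RamifiedSevenEllipticUnitsUltrametricTransfer
import Summits.BirchSwinnertonDyer.Rank1Residual.Additive.GordDescentField
import Mathlib.NumberTheory.RamificationInertia.Valuation
import Literature.NumberTheory.EllipticCurves.NeronLocalHeightCompletion
import HarnessLib

set_option linter.dupNamespace false
set_option autoImplicit false

/-!
# K7r crux `EllipticUnitValueSevenOfGZK` (stmt-BirchSwinnertonDyer-19945), line `rubin-formula-zp` —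
# the O11 FRAME PRIME IS TOTALLY RAMIFIED: `v_𝔭(p) = 2`, and the unit-power valuation lemma AT THE
# FRAME (`ord_𝔭((1 + y)^{p^m} − 1) = 1 + 2m` for `ord_𝔭 y = 1`) (cell `bsd-cm`, seat `bsd-cm-k7r-c3`
# g8; helper, `--supports` 19945; frame-side instance of `…UltrametricTransfer` §4, p485495)

HONEST FRAMING. Elementary algebraic number theory at the frame prime; nothing is asserted about
the crux; BSD is not proved by any of this. In the O11 frame `IsFrame W p K 𝔭 W' C` (`K` the
imaginary quadratic CM field with `discr K = d_K = cmFieldDiscrOfJ W.j`, `p ∣ d_K`, `p ≥ 5`,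
`𝔭 ∋ p`) the prime `𝔭` is the unique, RAMIFIED prime above `p`: `(p) = 𝔭²`. The tree had only
`v_𝔭(7) ≤ 2` (`SevenTorsion.exp_neg_two_le_intValuation_seven`, any quadratic `K`; that module sits in
the theses cone and is deliberately NOT imported); here the
EQUALITY from `p ∣ d_K` (the tree's `Additive.ramificationIdx_eq_two_of_dvd_discr` = Dedekind's
discriminant theorem for quadratic fields + Mathlib's `intValuation_liesOver`):
* `intValuation_natCast_eq_exp_neg_two_of_dvd_discr`: `[K : ℚ] = 2`, `p ∣ discr K`, `p ∈ 𝔭` ⇒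
  `𝔭.intValuation (p : 𝓞 K) = exp (−2)`; `valued_natCast_eq_exp_neg_two_of_dvd_discr`: the same in
  the completion `K_𝔭` (`Valued.v (p : K_𝔭) = exp (−2)`); `…_of_isFrame`: at the O11 frame.
* `valued_one_add_pow_prime_pow_sub_one_of_dvd_discr` / `…_of_isFrame`: for `y ∈ K_𝔭` with
  `Valued.v y = exp (−1)` (`ord_𝔭 y = 1`, e.g. `y = u − 1` for a topological generator `u` of
  `N¹ ∩ (1 + 𝔭)`) and `p ≥ 5`: `Valued.v ((1 + y)^(p^m) − 1) = exp (−(1 + 2m))` — ram g9's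
  «`ord_π(φ_ac(γ)^{7^m} − 1) = 1 + 2m`» (memo RELATIVE-RUBIN §1 (i)) AT THE FRAME, by
  `Ultrametric.map_one_add_pow_prime_pow_sub_one_of_ramificationTwo` with `π := y`.
* (appended) `valuation_ratCast_eq_of_dvd_discr` / `valued_ratCast_eq_of_dvd_discr` / `…_of_isFrame`
  (`ord_𝔭 x = 2·ord_p x` for `x ∈ ℚ^×`) and `valued_eq_of_sq_eq_ratCast_of_dvd_discr` / `…_of_isFrame`
  (`ρ² = r ∈ ℚ^× ⇒ Valued.v ρ = exp(−ord_p r)`): the bridge between the `padicValRat` currency of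
  the v3 statement layer (seat k7r-c4, `r = (L_W/L_{W₀})²`) and the `Valued.v` currency here.
NOT here: the generator `u = φ_ac(γ)` itself (needs the (T4) objects of [BKNO], tabled with
bsd-cited-lead); anything about `L`-functions.
References: J. Neukirch, *Algebraic Number Theory* (1999), I (8.2) (fundamental identity) and
III (2.12) (`p ∣ d_K ⟺ p` ramified) [NeukirchANT1999]; J.-P. Serre, *Local Fields* (1979), Ch. XIV
§4 Prop. 9 [Serre1979]; memo RELATIVE-RUBIN-ram-g9.md §1 (i).
-/

noncomputable section

namespace Summit.BirchSwinnertonDyer.BirchSwinnertonDyer.Theorems.RamifiedSevenEllipticUnits.Ultrametric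

open IsDedekindDomain IsDedekindDomain.HeightOneSpectrum NumberField WithZero
  Literature.NumberTheory.EllipticCurves Literature.NumberTheory.EllipticCurves.Rank1Residual

section Quadratic

variable {K : Type} [Field K] [NumberField K] (𝔭 : HeightOneSpectrum (𝓞 K)) {p : ℕ}
  [hp : Fact p.Prime]

/-- **`v_𝔭(p) = 2` at a ramified prime of a quadratic field**: for `[K : ℚ] = 2`, `p ∣ d_K` and a
prime `𝔭 ∋ p` of `𝓞 K`, `𝔭.intValuation (p : 𝓞 K) = exp (−2)`, i.e. `(p) = 𝔭²` locally at `𝔭`.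
Proof: `v_𝔭(p) = v_{(p)}(p)^{e(𝔭|p)}` over the place `(p)` of `ℤ` (Mathlib `intValuation_liesOver`),
`v_{(p)}(p) = exp(−1)`, and `e(𝔭|p) = 2` (`Additive.ramificationIdx_eq_two_of_dvd_discr`).
[cite: NeukirchANT1999, Ch. III (2.12) and Ch. I (8.2)] -/
theorem intValuation_natCast_eq_exp_neg_two_of_dvd_discr (h2 : Module.finrank ℚ K = 2)
    (hdvd : (p : ℤ) ∣ NumberField.discr K) (h𝔭 : (p : 𝓞 K) ∈ 𝔭.asIdeal) :
    𝔭.intValuation (p : 𝓞 K) = exp (-2) := by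
  have hp0 : (p : ℤ) ≠ 0 := by exact_mod_cast hp.out.ne_zero
  let v₀ : HeightOneSpectrum ℤ :=
    ⟨Ideal.span {(p : ℤ)}, (Ideal.span_singleton_prime hp0).mpr (Nat.prime_iff_prime_int.mp hp.out),
      by rw [Ne, Ideal.span_singleton_eq_bot]; exact hp0⟩
  haveI : 𝔭.asIdeal.LiesOver v₀.asIdeal :=
    Summit.BirchSwinnertonDyer.Rank1Residual.Additive.liesOver_span_of_natCast_mem p K 𝔭 h𝔭
  have hv₀ : v₀.intValuation (p : ℤ) = exp (-1) := intValuation_singleton v₀ hp0 rfl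
  have he : v₀.asIdeal.ramificationIdx' 𝔭.asIdeal = 2 :=
    Summit.BirchSwinnertonDyer.Rank1Residual.Additive.ramificationIdx_eq_two_of_dvd_discr p K 𝔭 h2
      hdvd h𝔭
  have hid := intValuation_liesOver v₀ 𝔭 (p : ℤ)
  rw [he, hv₀, map_natCast] at hid
  rw [← hid, pow_two, ← exp_add]
  norm_num

/-- **The same in the completion `K_𝔭`**: `Valued.v (p : K_𝔭) = exp (−2)`.
[cite: NeukirchANT1999, Ch. III (2.12) and Ch. II §4] -/
theorem valued_natCast_eq_exp_neg_two_of_dvd_discr (h2 : Module.finrank ℚ K = 2)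
    (hdvd : (p : ℤ) ∣ NumberField.discr K) (h𝔭 : (p : 𝓞 K) ∈ 𝔭.asIdeal) :
    Valued.v (p : 𝔭.adicCompletion K) = exp (-2) := by
  -- `Valued.v (p : K_𝔭) = v_𝔭(p : K) = 𝔭.intValuation (p : 𝓞 K)` (as in the tree's
  -- `SevenTorsion.valued_adicCompletion_intCast`, inlined to stay outside the theses cone)
  have h1 : Valued.v (algebraMap (𝓞 K) (𝔭.adicCompletion K) (p : 𝓞 K)) =
      𝔭.valuation K (algebraMap (𝓞 K) K (p : 𝓞 K)) :=
    valuedAdicCompletion_eq_valuation (K := K) 𝔭 (p : 𝓞 K)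
  rw [valuation_of_algebraMap (K := K) 𝔭 (p : 𝓞 K), map_natCast] at h1
  rw [h1, intValuation_natCast_eq_exp_neg_two_of_dvd_discr 𝔭 h2 hdvd h𝔭]

/-- **THE UNIT-POWER VALUATION LEMMA AT A RAMIFIED PRIME OF A QUADRATIC FIELD** (`p ≥ 5`): for
`y ∈ K_𝔭` with `ord_𝔭 y = 1` (`Valued.v y = exp (−1)`; e.g. `y = u − 1` for a topological generator
`u` of the norm-one principal units `N¹ ∩ (1 + 𝔭)`), `ord_𝔭((1 + y)^(p^m) − 1) = 1 + 2m` for every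
`m` — ram g9's «`ord_π(φ_ac(γ)^{7^m} − 1) = 1 + 2m`» in tree currency. By
`Ultrametric.map_one_add_pow_prime_pow_sub_one_of_ramificationTwo` with `π := y` and
`v_𝔭(p) = (v_𝔭 y)²`. [cite: Serre1979, Ch. XIV §4, Prop. 9 (proof)] -/
theorem valued_one_add_pow_prime_pow_sub_one_of_dvd_discr (h2 : Module.finrank ℚ K = 2)
    (hdvd : (p : ℤ) ∣ NumberField.discr K) (h𝔭 : (p : 𝓞 K) ∈ 𝔭.asIdeal) (h5 : 5 ≤ p)
    {y : 𝔭.adicCompletion K} (hy : Valued.v y = exp (-1)) (m : ℕ) :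
    Valued.v ((1 + y) ^ (p ^ m) - 1) = exp (-(1 + 2 * (m : ℤ))) := by
  have hπ0 : Valued.v y ≠ 0 := by rw [hy]; exact exp_ne_zero
  have hπ1 : Valued.v y < 1 := by rw [hy, ← exp_zero, exp_lt_exp]; norm_num
  have hpπ : Valued.v (p : 𝔭.adicCompletion K) = Valued.v y ^ 2 := by
    rw [valued_natCast_eq_exp_neg_two_of_dvd_discr 𝔭 h2 hdvd h𝔭, hy, ← exp_nsmul]
    norm_num
  rw [map_one_add_pow_prime_pow_sub_one_of_ramificationTwo Valued.v hp.out h5 hπ0 hπ1 hpπ rfl m,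
    hy, ← exp_nsmul]
  congr 1
  ring

end Quadratic

/-! ## At the O11 frame -/

section Frame

open WeierstrassCurve Summit.BirchSwinnertonDyer.Rank1Residual.X12.O11

variable {W : WeierstrassCurve ℚ} [W.IsElliptic] [W.IsGloballyMinimal] {p : ℕ} [hp : Fact p.Prime]
  {K : Type} [Field K] [NumberField K] {𝔭 : HeightOneSpectrum (𝓞 K)}
  {W' : WeierstrassCurve ℚ} {C : VariableChange ℚ}

omit [W.IsGloballyMinimal] hp in
/-- In the O11 frame, `p ∣ d_K = discr K` (`CMRamified W p` and `discr K = cmFieldDiscrOfJ W.j`).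
[cite: NeukirchANT1999, Ch. III (2.12)] -/
theorem dvd_discr_of_isFrame (hF : IsFrame W p K 𝔭 W' C) : (p : ℤ) ∣ NumberField.discr K := by
  obtain ⟨-, hram, -, -, hdisc, -, -⟩ := hF
  rw [hdisc]
  exact hram

omit [W.IsGloballyMinimal] in
/-- **THE O11 FRAME PRIME IS TOTALLY RAMIFIED: `v_𝔭(p) = 2`** (`𝔭.intValuation (p : 𝓞 K) = exp (−2)`).
[cite: NeukirchANT1999, Ch. III (2.12) and Ch. I (8.2)] -/
theorem intValuation_natCast_eq_exp_neg_two_of_isFrame (hF : IsFrame W p K 𝔭 W' C) :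
    𝔭.intValuation (p : 𝓞 K) = exp (-2) :=
  intValuation_natCast_eq_exp_neg_two_of_dvd_discr 𝔭 hF.2.2.2.1.1 (dvd_discr_of_isFrame hF)
    (by simpa using hF.2.2.2.2.2.1)

omit [W.IsGloballyMinimal] in
/-- … in the completion: `Valued.v (p : K_𝔭) = exp (−2)` at the O11 frame.
[cite: NeukirchANT1999, Ch. III (2.12) and Ch. II §4] -/
theorem valued_natCast_eq_exp_neg_two_of_isFrame (hF : IsFrame W p K 𝔭 W' C) :
    Valued.v (p : 𝔭.adicCompletion K) = exp (-2) :=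
  valued_natCast_eq_exp_neg_two_of_dvd_discr 𝔭 hF.2.2.2.1.1 (dvd_discr_of_isFrame hF)
    (by simpa using hF.2.2.2.2.2.1)

omit [W.IsGloballyMinimal] in
/-- **ram g9 §1 (i) AT THE O11 FRAME**: for `y ∈ K_𝔭` with `ord_𝔭 y = 1` and every `m`,
`ord_𝔭((1 + y)^(p^m) − 1) = 1 + 2m` (`Valued.v ((1 + y)^(p^m) − 1) = exp (−(1 + 2m))`); the frame
supplies `p ≥ 5` and `v_𝔭(p) = 2`. With `u := 1 + y = φ_ac(γ)` this is the valuation of the point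
`u^{p^m} − 1 ∈ 𝔭` at which `𝓛 ∈ 𝒪_𝔭⟦X⟧` is evaluated for the de Rham character `ξ_{p^m} = φ_ac^{p^m}`
(the (T4) objects themselves are not in the tree). [cite: Serre1979, Ch. XIV §4, Prop. 9 (proof)] -/
theorem valued_one_add_pow_prime_pow_sub_one_of_isFrame (hF : IsFrame W p K 𝔭 W' C)
    {y : 𝔭.adicCompletion K} (hy : Valued.v y = exp (-1)) (m : ℕ) :
    Valued.v ((1 + y) ^ (p ^ m) - 1) = exp (-(1 + 2 * (m : ℤ))) :=
  valued_one_add_pow_prime_pow_sub_one_of_dvd_discr 𝔭 hF.2.2.2.1.1 (dvd_discr_of_isFrame hF)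
    (by simpa using hF.2.2.2.2.2.1) hF.2.2.1 hy m

end Frame

/-! ## Rational numbers and their square roots at the frame prime: `ord_𝔭 r = 2·ord_p r`,
`ord_𝔭 ρ = ord_p(ρ²)` — the bridge between the `padicValRat` currency of the v3 statement layer
(`X12/O11/RamifiedRelativeValuationLineZp.lean`, seat k7r-c4: `r = (L_W/L_{W₀})² ∈ ℚ`, threshold
`1 + 2m`) and the `Valued.v` currency of the lemmas above (appended, seat `bsd-cm-k7r-c3` g8) -/

section RatCast

variable {K : Type} [Field K] [NumberField K] (𝔭 : HeightOneSpectrum (𝓞 K)) {p : ℕ}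
  [hp : Fact p.Prime]

/-- **`ord_𝔭 x = 2·ord_p x` for `x ∈ ℚ^×` at a ramified prime of a quadratic field**:
`𝔭.valuation K x = exp (−2·padicValRat p x)` (Mathlib `valuation_liesOver` over the place `(p)` of
`ℤ`, `e(𝔭|p) = 2`, and the tree's `Rat.HeightOneSpectrum.valuation_eq_exp_neg_padicValRat`).
[cite: NeukirchANT1999, Ch. II (4.8) and Ch. III (2.12)] -/
theorem valuation_ratCast_eq_of_dvd_discr (h2 : Module.finrank ℚ K = 2)
    (hdvd : (p : ℤ) ∣ NumberField.discr K) (h𝔭 : (p : 𝓞 K) ∈ 𝔭.asIdeal) {x : ℚ} (hx : x ≠ 0) :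
    𝔭.valuation K (x : K) = exp (-(2 * padicValRat p x)) := by
  set v₀ : HeightOneSpectrum ℤ := (Rat.HeightOneSpectrum.primesEquiv (R := ℤ)).symm ⟨p, hp.out⟩
    with hv₀def
  have hgen : Rat.HeightOneSpectrum.natGenerator v₀ = p :=
    congrArg Subtype.val ((Rat.HeightOneSpectrum.primesEquiv (R := ℤ)).apply_symm_apply ⟨p, hp.out⟩)
  have hspan : v₀.asIdeal = Ideal.span {(p : ℤ)} := by
    rw [Rat.HeightOneSpectrum.asIdeal_eq_span_natGenerator_int, hgen]
  haveI : 𝔭.asIdeal.LiesOver v₀.asIdeal := by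
    rw [hspan]
    exact Summit.BirchSwinnertonDyer.Rank1Residual.Additive.liesOver_span_of_natCast_mem p K 𝔭 h𝔭
  have he : v₀.asIdeal.ramificationIdx' 𝔭.asIdeal = 2 := by
    rw [hspan]
    exact Summit.BirchSwinnertonDyer.Rank1Residual.Additive.ramificationIdx_eq_two_of_dvd_discr p K 𝔭
      h2 hdvd h𝔭
  have hid := valuation_liesOver K v₀ 𝔭 (x : ℚ)
  rw [he, Rat.HeightOneSpectrum.valuation_eq_exp_neg_padicValRat v₀ hx, hgen, eq_ratCast] at hid
  rw [← hid, ← exp_nsmul]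
  congr 1
  ring

/-- … in the completion: `Valued.v (x : K_𝔭) = exp (−2·padicValRat p x)` for `x ∈ ℚ^×`.
[cite: NeukirchANT1999, Ch. II (4.8) and Ch. III (2.12)] -/
theorem valued_ratCast_eq_of_dvd_discr (h2 : Module.finrank ℚ K = 2)
    (hdvd : (p : ℤ) ∣ NumberField.discr K) (h𝔭 : (p : 𝓞 K) ∈ 𝔭.asIdeal) {x : ℚ} (hx : x ≠ 0) :
    Valued.v ((x : K) : 𝔭.adicCompletion K) = exp (-(2 * padicValRat p x)) := by
  rw [valuedAdicCompletion_eq_valuation' 𝔭 (x : K), valuation_ratCast_eq_of_dvd_discr 𝔭 h2 hdvd h𝔭 hx]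

/-- **`ord_𝔭 ρ = ord_p(ρ²)`**: if `ρ ∈ K_𝔭` squares to a non-zero rational `r` (`ρ² = r`; ram g9's
`ρ_k(D; D₀)` with `ρ² = r ∈ ℚ` — the Waldspurger shape), then `Valued.v ρ = exp (−padicValRat p r)`:
the `padicValRat` threshold / value of the v3 Props IS the `𝔭`-adic order of `ρ`.
[cite: NeukirchANT1999, Ch. II (4.8) and Ch. III (2.12)] -/
theorem valued_eq_of_sq_eq_ratCast_of_dvd_discr (h2 : Module.finrank ℚ K = 2)
    (hdvd : (p : ℤ) ∣ NumberField.discr K) (h𝔭 : (p : 𝓞 K) ∈ 𝔭.asIdeal) {r : ℚ} (hr : r ≠ 0)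
    {ρ : 𝔭.adicCompletion K} (hρ : ρ ^ 2 = ((r : K) : 𝔭.adicCompletion K)) :
    Valued.v ρ = exp (-padicValRat p r) := by
  have h : Valued.v ρ ^ 2 = exp (-padicValRat p r) ^ 2 := by
    rw [← map_pow, hρ, valued_ratCast_eq_of_dvd_discr 𝔭 h2 hdvd h𝔭 hr, ← exp_nsmul]
    congr 1
    ring
  exact (pow_left_inj₀ zero_le zero_le two_ne_zero).1 h

end RatCast

section FrameRatCast

open WeierstrassCurve Summit.BirchSwinnertonDyer.Rank1Residual.X12.O11

variable {W : WeierstrassCurve ℚ} [W.IsElliptic] [W.IsGloballyMinimal] {p : ℕ} [hp : Fact p.Prime]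
  {K : Type} [Field K] [NumberField K] {𝔭 : HeightOneSpectrum (𝓞 K)}
  {W' : WeierstrassCurve ℚ} {C : VariableChange ℚ}

omit [W.IsGloballyMinimal] in
/-- **At the O11 frame: `Valued.v (x : K_𝔭) = exp (−2·ord_p x)`** for `x ∈ ℚ^×`.
[cite: NeukirchANT1999, Ch. II (4.8) and Ch. III (2.12)] -/
theorem valued_ratCast_eq_of_isFrame (hF : IsFrame W p K 𝔭 W' C) {x : ℚ} (hx : x ≠ 0) :
    Valued.v ((x : K) : 𝔭.adicCompletion K) = exp (-(2 * padicValRat p x)) :=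
  valued_ratCast_eq_of_dvd_discr 𝔭 hF.2.2.2.1.1 (dvd_discr_of_isFrame hF)
    (by simpa using hF.2.2.2.2.2.1) hx

omit [W.IsGloballyMinimal] in
/-- **At the O11 frame: `ord_𝔭 ρ = ord_p(ρ²)`** for `ρ ∈ K_𝔭` with `ρ² = r ∈ ℚ^×`.
[cite: NeukirchANT1999, Ch. II (4.8) and Ch. III (2.12)] -/
theorem valued_eq_of_sq_eq_ratCast_of_isFrame (hF : IsFrame W p K 𝔭 W' C) {r : ℚ} (hr : r ≠ 0)
    {ρ : 𝔭.adicCompletion K} (hρ : ρ ^ 2 = ((r : K) : 𝔭.adicCompletion K)) :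
    Valued.v ρ = exp (-padicValRat p r) :=
  valued_eq_of_sq_eq_ratCast_of_dvd_discr 𝔭 hF.2.2.2.1.1 (dvd_discr_of_isFrame hF)
    (by simpa using hF.2.2.2.2.2.1) hr hρ

end FrameRatCast

end Summit.BirchSwinnertonDyer.BirchSwinnertonDyer.Theorems.RamifiedSevenEllipticUnits.Ultrametric

end
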